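import Literature.AlgebraicGeometry.FundamentalGroup.RiemannExistenceSmoothAffineCore
import Literature.AlgebraicGeometry.FundamentalGroup.RiemannExistenceQbarDescentProofs
import Literature.AlgebraicGeometry.Motives.AbelianVarietyProofs
import HarnessLib

/-!
# Riemann's existence theorem: the transcendental input, and `riemannExistence_qbarDescent_of_finiteIndex`

Layer `Literature/AlgebraicGeometry/FundamentalGroup`. We discharge the named fact
`riemannExistence_qbarDescent_of_finiteIndex` (SGA 1 XII Thm. 5.1 + XIII Cor. 4.6: every finite-index
subgroup of `π₁^top(X(ℂ))`, `X/ℚ̄` a variety, comes from a finite étale cover defined over `ℚ̄`).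

The tree's `riemannExistence_qbarDescent_of_finiteIndex_of_locallyAlgebraicSeparating`
(`RiemannExistenceQbarDescentProofs`: Theorem A = the algebraic half, normalization in the function
field of the étale-local algebraizations and descent to `ℚ̄`) reduces the fact to its transcendental
heart: for `S` a smooth irreducible affine `ℂ`-scheme, `q : T → S(ℂ)` a finite-fibred topological
covering and `P₀ ∈ S(ℂ)`, a function `h` continuous over an affine open `U ∋ P₀`, injective on
`q⁻¹(P₀)` and algebraic over `Γ(S, U)`. We produce it on an affine open `V ∋ P₀` carrying ÉTALE
COORDINATES (`EtaleCoordinates.exists_etaleCoordinates`, SGA 1 II 1.1 + I 7.6) from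
`SmoothAffineCore.exists_algebraicSeparating_of_etaleCoordinates` (Hörmander `L²` interpolation on the
Riemann domain `q⁻¹(V(ℂ)) → V(ℂ) → ℂᵈ`, growth towards the branch locus, Riemann extension and
Liouville), transporting along `Γ(V, 𝒪_V) ≅ Γ(S, V)`.

Everything is proved; `riemannExistence_qbarDescent_of_finiteIndex_holds` closes the fact with no new
named facts.

## References

* A. Grothendieck, M. Raynaud, *SGA 1*, Exp. XII Thm. 5.1 (p. 333), Exp. XIII Cor. 4.6. [SGA1]
* L. Hörmander, *An Introduction to Complex Analysis in Several Variables* (1973), Thm. 4.4.3–4.4.4, §5.4. [HormanderSCV1973]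
* A. Hatcher, *Algebraic Topology* (2002), §1.3 (classification of coverings). [HatcherAT2002]

#harness_tags algebraic_geometry.sga1, complex_geometry.riemann_existence, arithmetic_geometry.anabelian
-/

noncomputable section

open scoped Topology Polynomial
open CategoryTheory AlgebraicGeometry Set Filter Function
open Literature.AlgebraicGeometry.Motives
open Literature.NumberTheory.Transcendental

namespace Literature.AlgebraicGeometry.FundamentalGroup

namespace SmoothAffine

open HodgeTheory.AffineCoordinates EtaleCoordinates ZariskiLocal

/-- Evaluation at a complex point of an open subscheme `U ⊆ X` is compatible with the identification
`Γ(U, 𝒪_U) ≅ Γ(X, U)`. [folklore] -/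
theorem eval_topIso_hom (X : SchemeOver ℂ) (U : X.left.Opens) (P' : ComplexPoints (openSubschemeOver X U))
    {P : ComplexPoints X} (hP : AlgPoints.map (openSubschemeOverι X U) P' = P) (hU : P.pt ∈ U)
    (s : Γ((openSubschemeOver X U).left, ⊤)) :
    P.eval U hU (U.topIso.hom s) = P'.eval ⊤ trivial s := by
  subst hP
  rw [AlgPoints.eval_map]
  have h1 : (openSubschemeOverι X U).left.app U (U.topIso.hom s) =
      (openSubschemeOver X U).left.presheaf.map (homOfLE (le_top : (openSubschemeOverι X U).left ⁻¹ᵁ U ≤ ⊤)).op s := by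
    rw [openSubschemeOverι_left, Scheme.Opens.ι_app, Scheme.Opens.topIso_hom, ← CategoryTheory.comp_apply]
    refine congrArg (fun φ : X.left.presheaf.obj (Opposite.op (U.ι ''ᵁ ⊤)) ⟶ X.left.presheaf.obj (Opposite.op (U.ι ''ᵁ U.ι ⁻¹ᵁ U)) ↦
      (ConcreteCategory.hom φ) s) ?_
    exact ((X.left.presheaf.map_comp _ _).symm).trans rfl
  rw [h1, AlgPoints.eval_map_homOfLE]

open Literature.AlgebraicGeometry.Resolution in
/-- **The transcendental input to Riemann's existence theorem** (SGA 1 XII Thm. 5.1, proof, part 2),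
in the Zariski-local form consumed by
`riemannExistence_qbarDescent_of_finiteIndex_of_locallyAlgebraicSeparating`: for `S` a smooth
irreducible affine `ℂ`-scheme, `q : T → S(ℂ)` a covering map with finite fibres and `P₀ ∈ S(ℂ)`,
there are an affine open `U ∋ P₀`, a function `h : T → ℂ` continuous on `q⁻¹(U(ℂ))` and injective
on `q⁻¹(P₀)`, and a non-zero `F ∈ Γ(S, U)[τ]` with `F(q t)(h t) = 0` whenever `q t ∈ U(ℂ)`.
[cite: SGA1, Exp. XII Thm. 5.1 (p. 333), proof, part 2] [cite: HormanderSCV1973, Thm 4.4.3-4.4.4, §5.4] -/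
theorem exists_locallyAlgebraicSeparating (S : SchemeOver ℂ) [IsAffine S.left] [Smooth S.hom]
    [IrreducibleSpace S.left] (T : Type) [TopologicalSpace T] (q : T → ComplexPoints S)
    (hq : IsCoveringMap q) (hfin : ∀ t, (q ⁻¹' {t}).Finite) (P₀ : ComplexPoints S) :
    ∃ (U : S.left.Opens) (_ : IsAffineOpen U) (_ : P₀.pt ∈ U) (h : T → ℂ) (F : Polynomial Γ(S.left, U)),
      ContinuousOn h (q ⁻¹' {P | P.pt ∈ U}) ∧ F ≠ 0 ∧
      (∀ (t : T) (ht : (q t).pt ∈ U), (F.map ((q t).evalRingHom U ht)).eval (h t) = 0) ∧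
      InjOn h (q ⁻¹' {P₀}) := by
  classical
  haveI : LocallyOfFiniteType S.hom := inferInstance
  have hSreg : Scheme.IsRegular S.left := Scheme.IsRegular.of_smooth S.hom (Scheme.isRegular_Spec (CommRingCat.of ℂ))
  haveI : IsReduced S.left := hSreg.isReduced
  haveI : IsIntegral S.left := isIntegral_of_irreducibleSpace_of_isReduced _
  obtain ⟨d, hd⟩ := Motives.exists_smoothOfRelativeDimension_of_smooth S.hom
  haveI := hd
  -- étale coordinates on an affine open `V ∋ P₀`
  obtain ⟨V, hV, hP₀V, x, hxet⟩ := exists_etaleCoordinates S d P₀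
  haveI : IsAffine (openSubschemeOver S V).left := hV
  haveI : Nonempty (V : Scheme) := ⟨(⟨P₀.pt, hP₀V⟩ : V)⟩
  have hVint : IsIntegral (V : Scheme) := isIntegral_of_isOpenImmersion V.ι
  haveI : IsIntegral (openSubschemeOver S V).left := hVint
  haveI : SmoothOfRelativeDimension d (openSubschemeOver S V).hom := by
    have : SmoothOfRelativeDimension (0 + d) (V.ι ≫ S.hom) := inferInstance
    rwa [zero_add] at this
  haveI : Etale (coordHom (openSubschemeOver S V) x).left := hxet
  -- the restricted covering
  set q' := restrictTo q V with hq'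
  have hq'cov : IsCoveringMap q' := isCoveringMap_restrictTo q V hq
  have hq'fin : ∀ P', (q' ⁻¹' {P'}).Finite := finite_preimage_restrictTo q V hfin
  set P₀' : ComplexPoints (openSubschemeOver S V) := (pointsHomeomorph S V).symm ⟨P₀, hP₀V⟩ with hP₀'
  obtain ⟨h', F', hh', hF', hroot', hinj'⟩ :=
    SmoothAffineCore.exists_algebraicSeparating_of_etaleCoordinates (openSubschemeOver S V) d x hq'cov hq'fin P₀'
  -- transport to `S`
  set h : T → ℂ := fun t ↦ if ht : (q t).pt ∈ V then h' ⟨t, ht⟩ else 0 with hh_def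
  set F : Polynomial Γ(S.left, V) := F'.map V.topIso.hom.hom with hF_def
  have hq't : ∀ (t : T) (ht : (q t).pt ∈ V), AlgPoints.map (openSubschemeOverι S V) (q' ⟨t, ht⟩) = q t :=
    fun t ht ↦ map_restrictTo q V ⟨t, ht⟩
  refine ⟨V, hV, hP₀V, h, F, ?_, ?_, fun t ht ↦ ?_, ?_⟩
  · -- continuity on `q⁻¹(V(ℂ))`
    rw [continuousOn_iff_continuous_restrict]
    convert hh' using 1
    funext t
    have ht : (q t).pt ∈ V := t.2
    simp [hh_def, Set.restrict_apply, ht]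
  · -- `F ≠ 0`
    intro hF0
    apply hF'
    have h1 := congrArg (Polynomial.map V.topIso.inv.hom) hF0
    rw [Polynomial.map_zero, hF_def, Polynomial.map_map] at h1
    have h2 : V.topIso.inv.hom.comp V.topIso.hom.hom = RingHom.id _ := by
      rw [← CommRingCat.hom_comp, Iso.hom_inv_id, CommRingCat.hom_id]
    rwa [h2, Polynomial.map_id] at h1
  · -- the root relation
    have h1 : ((q t).evalRingHom V ht).comp V.topIso.hom.hom = (q' ⟨t, ht⟩).evalRingHom ⊤ trivial := by
      ext s
      exact eval_topIso_hom S V (q' ⟨t, ht⟩) (hq't t ht) ht s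
    rw [hF_def, Polynomial.map_map, h1]
    have : h t = h' ⟨t, ht⟩ := by simp [hh_def, ht]
    rw [this]
    exact hroot' ⟨t, ht⟩
  · -- injectivity on the fibre
    intro t₁ ht₁ t₂ ht₂ heq
    have hq₁ : q t₁ = P₀ := ht₁
    have hq₂ : q t₂ = P₀ := ht₂
    have hV₁ : (q t₁).pt ∈ V := hq₁ ▸ hP₀V
    have hV₂ : (q t₂).pt ∈ V := hq₂ ▸ hP₀V
    have hfib : ∀ (t : T) (ht : (q t).pt ∈ V), q t = P₀ → q' ⟨t, ht⟩ = P₀' := fun t ht hqt ↦ by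
      show (pointsHomeomorph S V).symm ⟨q t, ht⟩ = (pointsHomeomorph S V).symm ⟨P₀, hP₀V⟩
      congr 1
      exact Subtype.ext hqt
    have h₁ : h t₁ = h' ⟨t₁, hV₁⟩ := by simp [hh_def, hV₁]
    have h₂ : h t₂ = h' ⟨t₂, hV₂⟩ := by simp [hh_def, hV₂]
    rw [h₁, h₂] at heq
    have := hinj' (show q' ⟨t₁, hV₁⟩ ∈ ({P₀'} : Set _) from hfib t₁ hV₁ hq₁)
      (show q' ⟨t₂, hV₂⟩ ∈ ({P₀'} : Set _) from hfib t₂ hV₂ hq₂) heq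
    exact congrArg Subtype.val this

end SmoothAffine

/-- **SGA 1 XII Thm. 5.1 + XIII Cor. 4.6 (`riemannExistence_qbarDescent_of_finiteIndex`), discharged.**
Every finite-index subgroup of `π₁^top(X(ℂ), x)`, `X/ℚ̄` a variety, is the image of `π₁^top` of a
finite étale cover of `X_ℂ` defined over `ℚ̄`: the algebraic half is the tree's Theorem A
(`riemannExistence_qbarDescent_of_finiteIndex_of_locallyAlgebraicSeparating`), the transcendental half
is `SmoothAffine.exists_locallyAlgebraicSeparating`.
[cite: SGA1, Exp. XII Thm. 5.1 (p. 333), Exp. XIII Cor. 4.6] [cite: HatcherAT2002, Thm. 1.38] -/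
theorem riemannExistence_qbarDescent_of_finiteIndex_holds : riemannExistence_qbarDescent_of_finiteIndex :=
  riemannExistence_qbarDescent_of_finiteIndex_of_locallyAlgebraicSeparating
    fun S _ _ _ T _ q hq hfin P₀ ↦ SmoothAffine.exists_locallyAlgebraicSeparating S T q hq hfin P₀

end Literature.AlgebraicGeometry.FundamentalGroup
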